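import Summits.AtomisticToContinuum.HydrodynamicLimit.Theorems.JParityClosureRateFloorNoBurstsRung0Statics
import HarnessLib

/-!
# Crux `JParityClosure.RateFloor` (stmt-AtomisticToContinuum-13080), line `Sketch`: NO BURSTS AT RUNG 0 — file 3/3, assembly

Third of three files (see `…NoBurstsRung0Glue` for the overview and the glue/geometry/asymptotics, `…NoBurstsRung0Statics` for
the Gibbs statics).  THIS FILE discharges the registered stub S7a₀ `stub_noBurstsRung0` of the line `Sketch`: S7a "no bursts"
restricted to constant profiles `a, u, θ` (global equilibrium, where the local Gibbs law is the flow-invariant canonical Gibbs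
law).  With the window `Δ_N = windowLenB A b N = A (N+1)^{-b}` at `A = 1`, `b = 1/2`, the normalised burst count
`(ε/(N+1)) · lineBursts ε Δ_N τ` is `≤ η` with Gibbs probability `≥ 1 − δ` for all `N ≥ N₀(σ, τ, η, δ, u, θ)`.

Proof (assembly only).  The finite-`N` bound `RateFloorNoBursts.measure_bursts_rung0_le` (file 2/3: three-label Ruelle statics
for the multi-degree would-be pairs plus a GIVEN short-flight tail for the secondary incidences, both at level
`y = η(N+1)/(2ε)`) is fed with the landed rung-0 short-flight tail `EvenStressEnskog.shortFlightCountRung0_le` at flight window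
`ℓ = Δ_N`; after `⌊τ/Δ⌋ ≤ τ/Δ` and `(N+1)ε³ = σ³` the total is `C₁ Δ_N + C₂ Δ_N (N+1) ε_N²` (`rung0_bound_algebra`), and
`Δ_N → 0` (`tendsto_windowLenB`), `Δ_N (N+1) ε_N² = σ² (N+1)^{1/3-b} → 0` for `b = 1/2 > 1/3` (`tendsto_windowLenB_mul`).

References: C. Cercignani, R. Illner, M. Pulvirenti, *The Mathematical Theory of Dilute Gases* (1994), §2.2, App. 4.A;
D. Ruelle, *Statistical Mechanics: Rigorous Results* (1969), §4.2.
-/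

noncomputable section

open scoped BigOperators Topology ENNReal NNReal Classical
open MeasureTheory Set Filter Function
open Literature.Analysis.FluidPDE Literature.Analysis.FunctionSpaces Literature.MathematicalPhysics.KineticTheory

namespace Summit.AtomisticToContinuum.HydrodynamicLimit.Theorems

namespace RateFloorNoBursts

open RateFloorLine

/-! ### The total bound is eventually small (`A = 1`, `b = 1/2`) -/

/-- For `A = 1`, `b = 1/2` and any constants `C₁, C₂`, the total rung-0 bound
`C₁ Δ_N + C₂ · Δ_N (N+1) ε_N²` is `< δ` for all large `N` (`Δ_N → 0` and `Δ_N (N+1) ε_N² → 0` since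
`1/2 > 1/3`). [folklore] -/
theorem eventually_rung0_bound_lt (σ : ℝ) {δ : ℝ} (hδ : 0 < δ) (C₁ C₂ : ℝ) :
    ∃ N₁ : ℕ, ∀ N : ℕ, N₁ ≤ N →
      C₁ * windowLenB 1 (1 / 2) N +
          C₂ * (windowLenB 1 (1 / 2) N * (((N + 1 : ℕ) : ℝ) * hsDiameter σ N ^ 2)) < δ := by
  have h1 := (tendsto_windowLenB (1 : ℝ) (by norm_num : (0 : ℝ) < 1 / 2)).const_mul C₁
  have h2 := (tendsto_windowLenB_mul (1 : ℝ) σ (by norm_num : (1 : ℝ) / 3 < 1 / 2)).const_mul C₂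
  have h := h1.add h2
  have h0 : C₁ * (0 : ℝ) + C₂ * 0 = 0 := by ring
  rw [h0] at h
  exact eventually_atTop.1 (h.eventually (eventually_lt_nhds hδ))

/-! ### The registered stub S7a₀ -/

/-- **S7a₀ · NO BURSTS AT RUNG 0** (registered stub `stub_noBurstsRung0` of the line `Sketch`, crux
stmt-AtomisticToContinuum-13080, verbatim).  For constant profiles `a, θ > 0`, `u` there is `σ₀ > 0` such that for
`0 < σ < σ₀`, every family of hard-sphere flows `Φ`, `τ > 0` and `η, δ > 0`, with `A = 1`, `b = 1/2` and
`Δ_N = windowLenB A b N`, the Gibbs probability of the burst event `{η < ε/(N+1) · lineBursts ε Δ_N τ}` is `≤ δ`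
for all large `N`: `measure_bursts_rung0_le` fed with `EvenStressEnskog.shortFlightCountRung0_le` (`ℓ = Δ_N`,
`y = η(N+1)/(2ε)`), `⌊τ/Δ⌋ ≤ τ/Δ`, `rung0_bound_algebra`, `eventually_rung0_bound_lt`. [folklore] -/
theorem stub_noBurstsRung0 :
    ∀ (a θ : ℝ) (u : Literature.MathematicalPhysics.KineticTheory.V3), 0 < a → 0 < θ → ∃ σ₀ : ℝ, 0 < σ₀ ∧ ∀ σ : ℝ, 0 < σ → σ < σ₀ → ∀ Φ : (N : ℕ) → Literature.Analysis.FluidPDE.HardSphereFlow (Literature.Analysis.FluidPDE.Torus.geometry (Fin 3)) (Literature.MathematicalPhysics.KineticTheory.hsDiameter σ N) (N + 1), ∀ τ : ℝ, 0 < τ → ∀ η δ : ℝ, 0 < η → 0 < δ → ∃ A : ℝ, 0 < A ∧ ∃ b : ℝ, 1 / 3 ≤ b ∧ b ≤ 1 ∧ ∃ N₀ : ℕ, ∀ N : ℕ, N₀ ≤ N → let ε := Literature.MathematicalPhysics.KineticTheory.hsDiameter σ N; let γ := fun z (s : ℝ) => (Φ N).flow s z; Literature.MathematicalPhysics.KineticTheory.localGibbsLaw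 σ (fun _ => a) (fun _ => u) (fun _ => θ) N (Φ N) {z | η < ε / (N + 1 : ℝ) * lineBursts ε (windowLenB A b N) τ (γ z)} ≤ ENNReal.ofReal δ := by
  intro a θ u ha hθ
  obtain ⟨σ₁, hσ₁, hshortAll⟩ := EvenStressEnskog.shortFlightCountRung0_le a θ u ha hθ
  obtain ⟨σ₂, hσ₂, hsmall⟩ := exists_smallDensity uniformProfile one_pos
  refine ⟨min (min σ₁ σ₂) (1 / 2), lt_min (lt_min hσ₁ hσ₂) (by norm_num), ?_⟩
  intro σ hσ hσlt Φ τ hτ η δ hη hδ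
  have hσ₁' : σ < σ₁ := hσlt.trans_le ((min_le_left _ _).trans (min_le_left _ _))
  have hσ₂' : σ < σ₂ := hσlt.trans_le ((min_le_left _ _).trans (min_le_right _ _))
  have hσ2 : σ ≤ 1 / 2 := (hσlt.trans_le (min_le_right _ _)).le
  have hsm : SmallDensity uniformProfile σ := (hsmall σ hσ hσ₂').1
  -- the constants of the total bound `C₁ Δ + C₂ Δ (N+1) ε²` (`rung0_bound_algebra`)
  obtain ⟨N₁, hN₁⟩ := eventually_rung0_bound_lt σ hδ
    (2 * (1 + 4 * (‖u‖ ^ 2 + 3 * θ)) / η * (48 * σ ^ 3 + 192 * τ * σ ^ 3))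
    (2 * (1 + 4 * (‖u‖ ^ 2 + 3 * θ)) / η * (1536 * τ * σ ^ 3) + 4096 * τ * (‖u‖ ^ 2 + 3 * θ) * σ ^ 3 / η)
  refine ⟨1, one_pos, 1 / 2, by norm_num, by norm_num, max N₁ 1, fun N hN => ?_⟩
  dsimp only
  have hN₁N : N₁ ≤ N := (le_max_left _ _).trans hN
  have hN1 : 1 ≤ N := (le_max_right _ _).trans hN
  have hε0 : 0 < hsDiameter σ N := hsDiameter_pos hσ N
  have hn : (0 : ℝ) < (N + 1 : ℝ) := by positivity
  have hΔ : 0 < windowLenB 1 (1 / 2) N := by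
    rw [windowLenB]
    exact mul_pos one_pos (Real.rpow_pos_of_pos (by positivity) _)
  have hy : 0 < η * (N + 1 : ℝ) / (2 * hsDiameter σ N) := by positivity
  -- the landed rung-0 short-flight tail at `ℓ = Δ`, `y = η (N+1)/(2ε)`
  have hshort := hshortAll σ hσ hσ₁' N hN1 (Φ N) τ (windowLenB 1 (1 / 2) N)
    (η * (N + 1 : ℝ) / (2 * hsDiameter σ N)) hτ hΔ hy
  -- the finite-`N` bound of file 2/3
  have hmain := measure_bursts_rung0_le hσ hσ2 hsm ha hθ u (Φ N) hΔ hτ hη (by positivity) hshort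
  refine hmain.trans (ENNReal.ofReal_le_ofReal ?_)
  -- real arithmetic: `⌊τ/Δ⌋ ≤ τ/Δ`, `(N+1) ε³ = σ³`, `rung0_bound_algebra`, and `N ≥ N₁`
  have hc : ((N + 1 : ℕ) : ℝ) = (N + 1 : ℝ) := Nat.cast_succ N
  have hσ3 : (N + 1 : ℝ) * hsDiameter σ N ^ 3 = σ ^ 3 := by
    rw [← hc]
    exact succ_mul_hsDiameter_pow_three σ N
  have hfloor : (⌊τ / windowLenB 1 (1 / 2) N⌋₊ : ℝ) ≤ τ / windowLenB 1 (1 / 2) N :=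
    Nat.floor_le (div_pos hτ hΔ).le
  have halg := rung0_bound_algebra τ η (‖u‖ ^ 2 + 3 * θ) σ (N + 1 : ℝ) (hsDiameter σ N)
    (windowLenB 1 (1 / 2) N) hη.ne' hn.ne' hε0.ne' hΔ.ne' hσ3
  have hlt := hN₁ N hN₁N
  rw [hc] at hlt ⊢
  refine le_trans ?_ (halg.le.trans hlt.le)
  gcongr

end RateFloorNoBursts

end Summit.AtomisticToContinuum.HydrodynamicLimit.Theorems

end
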